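import Summits.Ventures.Crystal3D.Theorems.StickyWulffConstantCoaxialWallLawSeamJunkCapTableTwo
import Summits.Ventures.Crystal3D.Theorems.StickyWulffConstantCoaxialWallLawHealCapHexFive
import HarnessLib

/-!
# The junk cap table, third cut: row «hexagon − 1 + lower triple ⇒ 3» joins, `capTable₂ := capTable₁ ⊓ hexFiveCap` (crux `CoaxialWallLaw`, stmt-Ventures-19481;
# line `WallLedgerF`, skeleton 'CoaxialWallLawCertificates' v8.1, input `JunkCapBound` of `…SeamIncoherentAssembly`)

HONEST FRAMING. Venture `Summits/Ventures/Crystal3D` (cell `crystal3d-full`); bookkeeping only: the structural row `…HealCapHexFive.junk_contacts_le_three_of_hexFive`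
as a `JunkCapBound` instance (`junkCapBound_hexFiveCap`) and the lowered table **`capTable₂`** with **`junkCapBound_capTable₂`** and its read-off lemma.  Table so far
(value at a core ball `y`, minimum over the rows whose frame pattern some frame exhibits): kissing `12 − deg_D y`; eleven slots `0`; ten (nine + fcc upper `8`) `1`;
TEN′ (nine + hcp capper) `1`; nine (closed lower half-dozen) `2`; hexagon − 1 + lower triple `3`; hexagon only `4`.  Nothing about the stubs is claimed; F-C1 not moved.
-/

noncomputable section

namespace Summit.Ventures.Crystal3D.Theorems

namespace TailResidue

open Summit.Ventures.Crystal3D Finset NearIdentity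

/-- Row «hexagon − 1 + lower triple ⇒ `3`». -/
def hexFiveCap : Finset (EuclideanSpace ℝ (Fin 3)) → EuclideanSpace ℝ (Fin 3) → ℕ := patternCap HexFivePat 3

/-- The hexagon−1 row is a junk cap bound (`junk_contacts_le_three_of_hexFive`). -/
theorem junkCapBound_hexFiveCap : JunkCapBound hexFiveCap :=
  junkCapBound_patternCap fun _ hX _ _ S _ hy hzy L hL => junk_contacts_le_three_of_hexFive hX S hy hzy L hL

/-- **THE THIRD CAP TABLE**: `capTable₁ ⊓ hexFiveCap`. -/
def capTable₂ (D : Finset (EuclideanSpace ℝ (Fin 3))) (y : EuclideanSpace ℝ (Fin 3)) : ℕ := min (capTable₁ D y) (hexFiveCap D y)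

/-- **`JunkCapBound capTable₂`.** -/
theorem junkCapBound_capTable₂ : JunkCapBound capTable₂ := junkCapBound_min junkCapBound_capTable₁ junkCapBound_hexFiveCap

/-- The third table lowers the second. -/
theorem capTable₂_le_capTable₁ (D : Finset (EuclideanSpace ℝ (Fin 3))) (y : EuclideanSpace ℝ (Fin 3)) : capTable₂ D y ≤ capTable₁ D y := min_le_left _ _

/-- Reading the table, hexagon−1 row: an exhibited frame with `lowerNine ∖ {0}` in the core gives `capTable₂ D y ≤ 3`. -/
theorem capTable₂_le_three_of_hexFive {D : Finset (EuclideanSpace ℝ (Fin 3))} {y : EuclideanSpace ℝ (Fin 3)} (L : EuclideanSpace ℝ (Fin 3) ≃ₗᵢ[ℝ] EuclideanSpace ℝ (Fin 3))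
    (h : ∀ k ∈ lowerNine, k ≠ 0 → y + L (slotSite k) ∈ D) : capTable₂ D y ≤ 3 :=
  (min_le_right _ _).trans (patternCap_le_of_pat (pat := HexFivePat) L h)

/-- **The assembly with the junk input discharged, third table.** -/
theorem incoherentSeamSmall_of_cert_of_sparsity₂ {cap : Finset (EuclideanSpace ℝ (Fin 3)) → EuclideanSpace ℝ (Fin 3) → ℕ} (hle : ∀ D y, capTable₂ D y ≤ cap D y)
    {s s₁ p₀ : ℝ} {n₀ k₀ : ℕ} (hcert : CoherentCoreCap cap s₁) (hsp : SeamSparsity p₀ n₀ k₀) (hp₀ : 0 < p₀) (hs : s₁ + n₀ / p₀ ≤ s) :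
    IncoherentSeamSmall s k₀ :=
  incoherentSeamSmall_of_assembly cap hcert (junkCapBound_mono junkCapBound_capTable₂ hle) hsp hp₀ hs

end TailResidue

end Summit.Ventures.Crystal3D.Theorems

end
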